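import Mathlib
import HarnessLib
import Summits.AtomisticToContinuum.FouriersLaw.Theses.OddSectorIrreversibility

/-!
# SketchIdeator2B — crux-ideate stmt-AtomisticToContinuum-15159 (`TapLeakBound`), ideator 2, card
`far-bath-transmission-functional`

Defs only (First lemma + the transferred targets); nothing here is a skeleton.
`w_R = γ (T - p_{N-1}²)` is the work rate of the right bath, `v` its corrector (`L v = -w_R`,
characterised as the a.e.-limit of the finite-horizon integrals exactly as the Kubo corrector `u` is in
the route file), `M = Σ_k k·h_k` the energy first moment (weight `0` at the left contact, so
`∂_{p_0} M = 0`).  The substitution `u = ⟨M⟩ - M - (N-1)·v` turns every near-contact derivative of `u`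
into `-(N-1)` times that of `v`.
-/

namespace Summit.AtomisticToContinuum.FouriersLaw.Cruxes.TapLeakBound.Transmission

open MeasureTheory
open Literature.MathematicalPhysics.KineticTheory.HeatConduction

noncomputable section

/-- The Ornstein–Uhlenbeck tap operator at site `b`: `𝒩_b f = -(T ∂_{p_b}∂_{p_b} f) + p_b ∂_{p_b} f`. -/
def bathOp {N : ℕ} (T : ℝ) (b : Fin N) (f : PhaseSpace N → ℝ) (x : PhaseSpace N) : ℝ :=
  -(T * partialP b (partialP b f) x) + x.2 b * partialP b f x

/-- The work rate of the bath at site `b` at temperature `T`: `w_b = γ (T - p_b²)`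
(`generator_hamiltonian_two_baths`: `L H = w_0 + w_{N-1}`). -/
def workRate {N : ℕ} (γ T : ℝ) (b : Fin N) (x : PhaseSpace N) : ℝ :=
  γ * (T - x.2 b ^ 2)

/-- **FIRST LEMMA (fixed `N ≥ 2`, exact) — TRANSMISSION SUBSTITUTION.**  If `u` is the Kubo corrector
(a.e.-limit of `∫₀^τ P_t J`) and `v` the work corrector of the RIGHT bath (a.e.-limit of
`∫₀^τ P_t w_{N-1}`), both `C¹`, then the left-contact momentum derivative of `u` is `-(N-1)` times that
of `v`, pointwise: Dynkin for the energy moment `M` (`L M = J + (N-1) w_R`) gives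
`∫₀^τ P_t J = P_τ M - M - (N-1) ∫₀^τ P_t w_R`, `P_τ M → ⟨M⟩`, and `∂_{p_0} M = 0`.  Companions (same
proof): `𝒩_0 u = -(N-1) 𝒩_0 v`, `∂_{q_0} u = ½ V'(r_0) - (N-1) ∂_{q_0} v`, `∂_{p_1} u = -p_1 - (N-1) ∂_{p_1} v`;
mirror statements at the right contact with the left bath's work corrector. Harmonic member: exact to
`1e-11`, `N ≤ 64` (kit j016463). -/
def TransmissionSubstitution : Prop :=
  ∀ ω₂ lam β γ : ℝ, 0 < ω₂ → 0 < lam → 0 < β → 0 < γ → ∀ T : ℝ, 0 < T →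
    ∀ (N : ℕ) (b₀ b₁ : Fin N) (u v : PhaseSpace N → ℝ), 2 ≤ N → b₀.val = 0 → b₁.val = N - 1 →
    let P := pinnedChain ω₂ lam β γ
    let μT : Measure (PhaseSpace N) :=
      volume.withDensity (fun x => ENNReal.ofReal (Real.exp (-(P.hamiltonian N x) / T)))
    let J : PhaseSpace N → ℝ := fun z => ∑ k : Fin N, P.bondCurrent N k z
    let wR : PhaseSpace N → ℝ := workRate γ T b₁
    ContDiff ℝ 1 u → ContDiff ℝ 1 v →
    (∀ᵐ x ∂μT, Filter.Tendsto (fun τ : ℝ => ∫ t in Set.Ioc (0 : ℝ) τ,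
        (∫ y, J y ∂(P.transitionKernel N T T t.toNNReal x))) Filter.atTop (nhds (u x))) →
    (∀ᵐ x ∂μT, Filter.Tendsto (fun τ : ℝ => ∫ t in Set.Ioc (0 : ℝ) τ,
        (∫ y, wR y ∂(P.transitionKernel N T T t.toNNReal x))) Filter.atTop (nhds (v x))) →
    ∀ x, partialP b₀ u x = -(((N : ℝ) - 1) * partialP b₀ v x)

/-- The landed tap identity in the transmission variable (conductance = sensitivity of the far bath's
work to the near contact momentum): `γ T (N-1)² (‖∂_{p_0} v_R‖² + ‖∂_{p_{N-1}} v_L‖²) = ∫ u J dμ_T`,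
i.e. `‖∂_{p_0} v_R‖²_π = T D_N / (2γ(N-1))` by the mirror symmetry. Stated for the right-bath
corrector at the left contact together with its mirror `v'` (left-bath corrector) at the right contact. -/
def TransmissionTapIdentity : Prop :=
  ∀ ω₂ lam β γ : ℝ, 0 < ω₂ → 0 < lam → 0 < β → 0 < γ → ∀ T : ℝ, 0 < T →
    ∀ (N : ℕ) (b₀ b₁ : Fin N) (u v v' : PhaseSpace N → ℝ), 2 ≤ N → b₀.val = 0 → b₁.val = N - 1 →
    let P := pinnedChain ω₂ lam β γ
    let μT : Measure (PhaseSpace N) :=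
      volume.withDensity (fun x => ENNReal.ofReal (Real.exp (-(P.hamiltonian N x) / T)))
    let J : PhaseSpace N → ℝ := fun z => ∑ k : Fin N, P.bondCurrent N k z
    ContDiff ℝ 1 u → ContDiff ℝ 1 v → ContDiff ℝ 1 v' → MemLp u 2 μT →
    (∀ᵐ x ∂μT, Filter.Tendsto (fun τ : ℝ => ∫ t in Set.Ioc (0 : ℝ) τ,
        (∫ y, J y ∂(P.transitionKernel N T T t.toNNReal x))) Filter.atTop (nhds (u x))) →
    (∀ᵐ x ∂μT, Filter.Tendsto (fun τ : ℝ => ∫ t in Set.Ioc (0 : ℝ) τ,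
        (∫ y, workRate γ T b₁ y ∂(P.transitionKernel N T T t.toNNReal x))) Filter.atTop (nhds (v x))) →
    (∀ᵐ x ∂μT, Filter.Tendsto (fun τ : ℝ => ∫ t in Set.Ioc (0 : ℝ) τ,
        (∫ y, workRate γ T b₀ y ∂(P.transitionKernel N T T t.toNNReal x))) Filter.atTop (nhds (v' x))) →
    γ * T * ((N : ℝ) - 1) ^ 2 *
        ((∫ x, (partialP b₀ v x) ^ 2 ∂μT) + ∫ x, (partialP b₁ v' x) ^ 2 ∂μT)
      = ∫ x, u x * J x ∂μT

/-- **TRANSFERRED TARGET (equivalent to H1 = `BoundaryHermiteRegularity` by `𝒩_0 u⁺ = -(N-1) 𝒩_0 v⁺`):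
TRANSMISSION HERMITE REGULARITY.** The second `p_0`-Hermite content of the even part of the far bath's
work corrector is at most the tap scale: `(N-1)² ∫ (𝒩_0 v⁺)² dμ_T ≤ C (|∫ u J dμ_T| + Z)`, i.e.
`‖𝒩_0 v⁺‖²_π ≲ T² D_N/(N-1) + (N-1)⁻²` — intensive. -/
def TransmissionHermiteRegularity : Prop :=
  ∀ ω₂ lam β γ : ℝ, 0 < ω₂ → 0 < lam → 0 < β → 0 < γ → ∀ T : ℝ, 0 < T → ∃ C : ℝ,
    ∀ (N : ℕ) (b₀ b₁ : Fin N) (u v : PhaseSpace N → ℝ), 2 ≤ N → b₀.val = 0 → b₁.val = N - 1 →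
    let P := pinnedChain ω₂ lam β γ
    let μT : Measure (PhaseSpace N) :=
      volume.withDensity (fun x => ENNReal.ofReal (Real.exp (-(P.hamiltonian N x) / T)))
    let J : PhaseSpace N → ℝ := fun z => ∑ k : Fin N, P.bondCurrent N k z
    let ve : PhaseSpace N → ℝ := fun x => (v x + v (x.1, -x.2)) / 2
    ContDiff ℝ 3 u → ContDiff ℝ 3 v → MemLp u 2 μT →
    (∀ᵐ x ∂μT, Filter.Tendsto (fun τ : ℝ => ∫ t in Set.Ioc (0 : ℝ) τ,
        (∫ y, J y ∂(P.transitionKernel N T T t.toNNReal x))) Filter.atTop (nhds (u x))) →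
    (∀ᵐ x ∂μT, Filter.Tendsto (fun τ : ℝ => ∫ t in Set.Ioc (0 : ℝ) τ,
        (∫ y, workRate γ T b₁ y ∂(P.transitionKernel N T T t.toNNReal x))) Filter.atTop (nhds (v x))) →
    MemLp (bathOp T b₀ ve) 2 μT ∧
    ((N : ℝ) - 1) ^ 2 * ∫ x, (bathOp T b₀ ve x) ^ 2 ∂μT
      ≤ C * (|∫ x, u x * J x ∂μT| + ∫ x, Real.exp (-(P.hamiltonian N x) / T) ∂volume)

/-- Card A's second-order tap identity in the transmission variable has NO local source term
(`∂_{p_0} w_R = 0` for `N ≥ 2`): `γ (‖𝒩_0 v‖² + ⟨𝒩_{N-1} v, 𝒩_0 v⟩) = T ⟨∂_{q_0} v, ∂_{p_0} v⟩`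
(pair `L v = -w_R` with `𝒩_0 v`). Harmonic member exact (kit j016463). Growth class as in card A. -/
def TransmissionSecondTapIdentity : Prop :=
  ∀ ω₂ lam β γ : ℝ, 0 < ω₂ → 0 < lam → 0 < β → 0 < γ → ∀ T : ℝ, 0 < T →
    ∀ (N : ℕ) (b₀ b₁ : Fin N) (v : PhaseSpace N → ℝ), 2 ≤ N → b₀.val = 0 → b₁.val = N - 1 →
    let P := pinnedChain ω₂ lam β γ
    let μT : Measure (PhaseSpace N) :=
      volume.withDensity (fun x => ENNReal.ofReal (Real.exp (-(P.hamiltonian N x) / T)))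
    ContDiff ℝ 3 v →
    (∃ θ C : ℝ, 2 * θ < 1 / T ∧ ∀ k : ℕ, k ≤ 3 → ∀ x : PhaseSpace N,
        ‖iteratedFDeriv ℝ k v x‖ ≤ C * Real.exp (θ * P.hamiltonian N x)) →
    (∀ x, P.generator N T T v x = -workRate γ T b₁ x) →
    γ * ((∫ x, bathOp T b₀ v x * bathOp T b₀ v x ∂μT) + ∫ x, bathOp T b₁ v x * bathOp T b₀ v x ∂μT)
      = T * ∫ x, partialQ b₀ v x * partialP b₀ v x ∂μT

example : Prop := Summit.AtomisticToContinuum.FouriersLaw.Theses.OddSectorIrreversibility.TapLeakBound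

end

end Summit.AtomisticToContinuum.FouriersLaw.Cruxes.TapLeakBound.Transmission
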